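import Mathlib

/-!
# Solo-blind O1b, E72: a principal ideal of a local ring is generated by one of its given generators

Ring-theoretic core (Nakayama step) of THEOREM Φ8 (i) ⟹ (ii) of the solo-blind Eisenstein study
(`paper/theoremPhi.md` §5(l)): if the Eisenstein ideal `I = (η_w : w) · T` of the local Hecke
algebra `T` is principal, then it is generated by a single `η_{w₀}`; equivalently, if no `η_w`
generates `I`, then `I` is not principal.  Stated here for an arbitrary commutative local ring and
an arbitrary nonempty generating set; no Noetherian hypothesis is needed.
-/

namespace Summit.Langlands.Langlands.Theorems

/-- **E72.** In a commutative local ring, if the ideal generated by a nonempty set `S` is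
principal, then it is generated by a single element of `S`.  (If `span S = (x)` and no `s ∈ S` is a
unit multiple of `x`, then `S ⊆ 𝔪x`, so `x ∈ 𝔪x`, whence `x = 0` and every `s ∈ S` is `0`.) -/
theorem soloBlind_exists_mem_span_eq_span_singleton_of_isPrincipal
    {R : Type*} [CommRing R] [IsLocalRing R] {S : Set R} (hS : S.Nonempty)
    (hI : (Ideal.span S).IsPrincipal) :
    ∃ s ∈ S, Ideal.span S = Ideal.span {s} := by
  obtain ⟨⟨x, hx⟩⟩ := hI
  have hx' : Ideal.span S = Ideal.span {x} := hx
  by_cases hcase : ∃ s ∈ S, ∃ a : R, IsUnit a ∧ a * x = s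
  · obtain ⟨s, hsS, a, ha, rfl⟩ := hcase
    exact ⟨a * x, hsS, by rw [hx', Ideal.span_singleton_mul_left_unit ha]⟩
  · push Not at hcase
    -- every element of `S` is a non-unit multiple of `x`
    have hle : Ideal.span S ≤ IsLocalRing.maximalIdeal R * Ideal.span {x} := by
      rw [Ideal.span_le]
      intro s hs
      have hs' : s ∈ Ideal.span {x} := hx' ▸ Ideal.subset_span hs
      obtain ⟨a, rfl⟩ := Ideal.mem_span_singleton'.mp hs'
      have ha : ¬ IsUnit a := fun hu => hcase _ hs a hu rfl
      exact Ideal.mul_mem_mul ((IsLocalRing.mem_maximalIdeal _).mpr ha)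
        (Ideal.mem_span_singleton_self x)
    -- hence `x ∈ 𝔪 x`, so `x = 0`
    have hxmem : x ∈ IsLocalRing.maximalIdeal R * Ideal.span {x} :=
      hle (hx' ▸ Ideal.mem_span_singleton_self x)
    obtain ⟨z, hz, hzx⟩ := Ideal.mem_mul_span_singleton.mp hxmem
    have hu : IsUnit (1 - z) :=
      IsLocalRing.isUnit_one_sub_self_of_mem_nonunits z
        ((IsLocalRing.mem_maximalIdeal z).mp hz)
    have hx0 : x = 0 := by
      have h1 : (1 - z) * x = 0 := by rw [sub_mul, one_mul, hzx, sub_self]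
      exact (hu.mul_right_eq_zero).mp h1
    obtain ⟨s, hsS⟩ := hS
    have hs0 : s = 0 := by
      have hs' : s ∈ Ideal.span {x} := hx' ▸ Ideal.subset_span hsS
      rw [hx0] at hs'
      simpa using hs'
    exact ⟨s, hsS, by rw [hx', hx0, hs0]⟩

/-- **E72, contrapositive form used in THEOREM Φ8 / Φ10:** if no element of the nonempty
generating set `S` generates `span S` on its own, then `span S` is not principal. -/
theorem soloBlind_not_isPrincipal_of_forall_span_singleton_ne
    {R : Type*} [CommRing R] [IsLocalRing R] {S : Set R} (hS : S.Nonempty)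
    (h : ∀ s ∈ S, Ideal.span S ≠ Ideal.span {s}) :
    ¬ (Ideal.span S).IsPrincipal := fun hI => by
  obtain ⟨s, hs, hEq⟩ := soloBlind_exists_mem_span_eq_span_singleton_of_isPrincipal hS hI
  exact h s hs hEq

end Summit.Langlands.Langlands.Theorems
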